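import Mathlib
import Summits.NavierStokesRegularity.NavierStokesRegularity.Theses.FilamentSkeletonRss
import Literature.Analysis.FluidPDE.GaussianVortexPlanar

/-!
# CoreGluingGivenInvertibility — crux-ideate round 1, ideator 1: first lemmas of the two idea cards

Crux `stmt-NavierStokesRegularity-17944` =
`Summit.NavierStokesRegularity.NavierStokesRegularity.Theses.FilamentSkeletonRss.CoreGluingGivenInvertibility`
(`CoreLinearInvertibility → CoreGluing`). Nothing here is proposed to the tree; every `def … : Prop`
is the FIRST CHECKABLE STATEMENT of a line (cards `arnold-energy-fibre`, `core-choking`), typed over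
existing declarations so that a crux-plan seat can turn it into a stub. Small lemmas are PROVED.
-/

noncomputable section

namespace Summit.NavierStokesRegularity.NavierStokesRegularity.Cruxes.CoreGluingGivenInvertibility.Sketch

open MeasureTheory Real Set Filter Topology
open scoped InnerProductSpace Laplacian ContDiff

/-- The crux, by name (sanity: the decl the line must conclude). -/
example : Theses.FilamentSkeletonRss.CoreGluingGivenInvertibility =
    (Theses.FilamentSkeletonRss.CoreLinearInvertibility → Theses.FilamentSkeletonRss.CoreGluing) :=
  rfl

/-! ## Card `arnold-energy-fibre` — Arnold's quadratic form at the (strained) Gaussian cross-section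

Planar vocabulary of `GaussianVortexPlanar.lean`: `L_λ = strainedVorticityOperator lam`
(`L_λ = L + λM`, `L = Δ + ½x·∇ + 1`, `λM = −{ψ_λ, ·}` with the strain stream function
`ψ_λ = (λ/2) x₀x₁`), `G = gaussVortexProfile`, `v^G = gaussVortexVelocity`, `K_{2D}∗ = biotSavart2D`,
`φ = burgersPhi`. The linearised transport at the Gaussian of circulation `R` is
`R Λ_G w = R (v^G·∇w + (K_{2D}∗w)·∇G)`; CoreLinearInvertibility asks `c²∫G_λ⁻¹w² ≤ ∫G_λ⁻¹((L_λ − RΛ_G)w)²`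
on `{∫w = ∫x₀w = ∫x₁w = 0}`. The card replaces the weight `G_λ⁻¹` by ARNOLD'S WEIGHT
`𝒜 = −∇ψ̄/∇ω̄` of the base vortex and the inner product by Arnold's form `J(w) = ½∫(𝒜w² + ψ_w w)`. -/

section Planar

open Literature.Analysis.FluidPDE

/-- Local notation for the cross-section plane. -/
local notation "ℝ²" => EuclideanSpace ℝ (Fin 2)

/-- Arnold's weight at the Gaussian vortex, `𝒜(x) = −ψ_G'(r)/G'(r) = 4|x|⁻²(e^{|x|²/4} − 1)`
(Gallay–Šverák 2024, Lemma 4.1 / (def:A) of Dolce–Gallay 2026), written junk-free as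
`e^{|x|²/4} φ(|x|²/4)` with `φ(s) = (1 − e^{−s})/s`, `φ(0) = 1` (so `𝒜(0) = 1`, `𝒜 ≍ e^{|x|²/4}/|x|²`). -/
def arnoldWeight (x : ℝ²) : ℝ :=
  Real.exp (‖x‖ ^ 2 / 4) * burgersPhi (‖x‖ ^ 2 / 4)

/-- `𝒜 > 0`. -/
theorem arnoldWeight_pos (x : ℝ²) : 0 < arnoldWeight x :=
  mul_pos (Real.exp_pos _) (burgersPhi_pos _)

/-- `𝒜(0) = 1` (no junk at the origin). -/
theorem arnoldWeight_zero : arnoldWeight 0 = 1 := by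
  simp [arnoldWeight]

/-- Off the origin, `𝒜(x) = 4 (e^{|x|²/4} − 1)/|x|²` — the printed form. -/
theorem arnoldWeight_eq_of_ne_zero {x : ℝ²} (hx : x ≠ 0) :
    arnoldWeight x = 4 * (Real.exp (‖x‖ ^ 2 / 4) - 1) / ‖x‖ ^ 2 := by
  have hn : ‖x‖ ^ 2 / 4 ≠ 0 := by positivity
  have hx2 : ‖x‖ ^ 2 ≠ 0 := by positivity
  rw [arnoldWeight, burgersPhi_of_ne_zero hn]
  have hexp : Real.exp (‖x‖ ^ 2 / 4) * Real.exp (-(‖x‖ ^ 2 / 4)) = 1 := by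
    rw [← Real.exp_add]; simp
  field_simp
  nlinarith [hexp]

/-- The planar stream function `ψ_w = (2π)⁻¹ log|·| ∗ w` (`Δψ_w = w`; Gallay–Šverák 2024, (psidef)).
Bochner integral (junk `0` where not integrable — never, for `w ∈ C_c`). -/
def streamFn (w : ℝ² → ℝ) (x : ℝ²) : ℝ :=
  ∫ y, (2 * Real.pi)⁻¹ * Real.log ‖x - y‖ * w y

/-- The linearised planar transport at a base vorticity `ω̄`:
`Λ_{ω̄} w = (K∗ω̄)·∇w + (K∗w)·∇ω̄ = {ψ_{ω̄}, w} + {ψ_w, ω̄}`. At `ω̄ = G` this is `Λ_G`. -/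
def linTransport (ωbar w : ℝ² → ℝ) (x : ℝ²) : ℝ :=
  ⟪biotSavart2D ωbar x, gradient w x⟫_ℝ + ⟪biotSavart2D w x, gradient ωbar x⟫_ℝ

/-- The full linearised sectional operator at a base vortex `ω̄` in strain `λ`:
`T_{ω̄} w = L_λ w − Λ_{ω̄} w`; at `ω̄ = R·G` it is CoreLinearInvertibility's `L_λ − RΛ_G`. -/
def linCoreOp (lam : ℝ) (ωbar w : ℝ² → ℝ) (x : ℝ²) : ℝ :=
  strainedVorticityOperator lam w x - linTransport ωbar w x

/-- The deviatoric strain velocity `u_λ(x) = (−(λ/2)x₀, (λ/2)x₁)` (`L_λ w = L w − u_λ·∇w`), stream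
function `ψ_λ = (λ/2)x₀x₁`. -/
def strainVel (lam : ℝ) (x : ℝ²) : ℝ² :=
  WithLp.toLp 2 ![-(lam / 2) * x 0, (lam / 2) * x 1]

/-- Gallay–Šverák's diffusive quadratic form `Q_𝒜(w) = ∫(𝒜|∇w|² − 𝓑 w²)` with
`𝓑 = 1 + ½(Δ𝒜 − ½x·∇𝒜 + 𝒜)` (their (Qdef2)–(Bdef), computed for a general smooth weight). -/
def diffusiveForm (A : ℝ² → ℝ) (w : ℝ² → ℝ) : ℝ :=
  ∫ x, (A x * ‖gradient w x‖ ^ 2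
    - (1 + (Δ A x - (1 / 2 : ℝ) * ⟪(x : ℝ²), gradient A x⟫_ℝ + A x) / 2) * w x ^ 2)

/-- **First lemma of the line (λ = 0, PRINTED-ADJACENT; polarised Gallay–Šverák 2024 Prop. 4.3).**
For every circulation `R` and every smooth compactly supported test vorticity `w`, pairing the
linearised operator `(L − RΛ_G)w` against Arnold's dual element `𝒜w + ψ_w` gives MINUS the diffusive
form, with the `R`-terms dropping out EXACTLY:
`∫ (𝒜 w + ψ_w)·((L − RΛ_G) w) = −Q_𝒜(w)`.
(GS prove `J' = −Q − N` along the nonlinear flow; the linear part of that computation is this identity.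
It is the mechanism replacing Gallay–Wayne's accidental skewness of `Λ_G` in `L²(G⁻¹)`.) -/
def ArnoldSteadyIdentityGauss : Prop :=
  ∀ (R : ℝ) (w : ℝ² → ℝ), ContDiff ℝ ∞ w → HasCompactSupport w →
    ∫ x, (arnoldWeight x * w x + streamFn w x) *
        linCoreOp 0 (fun y => R * gaussVortexProfile y) w x
      = - diffusiveForm arnoldWeight w

/-- **Coercivity of the diffusive form (Gallay–Šverák 2024, Thm. 4.2, stated on a core).** There is
`δ > 0` with `Q_𝒜(w) ≥ δ ∫𝒜 w²` for all smooth compactly supported `w` with zero mass and zero first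
moments. [cite: GallaySverak2024 = arXiv:2110.13739, Thm. 4.2 — to be vendored as a named fact] -/
def ArnoldDiffusiveCoercivity : Prop :=
  ∃ δ : ℝ, 0 < δ ∧ ∀ w : ℝ² → ℝ, ContDiff ℝ ∞ w → HasCompactSupport w →
    ∫ x, w x = 0 → ∫ x, x 0 * w x = 0 → ∫ x, x 1 * w x = 0 →
    δ * ∫ x, arnoldWeight x * w x ^ 2 ≤ diffusiveForm arnoldWeight w

/-- **Target of the line's first stub (what 17944 consumes in the k = 0 sector, λ = 0 case):
uniform-in-circulation a priori bound in Arnold's weight, ALL angular parities.**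
`∃ c > 0, ∀ R, ∀ w ∈ C_c^∞ ∩ {mass = first moments = 0}: c² ∫𝒜 w² ≤ ∫𝒜 ((L − RΛ_G)w)²`.
(From the two facts above by Cauchy–Schwarz: `δ‖w‖²_𝒜 ≤ Q = −⟨𝒜w + ψ_w, Tw⟩ ≤ C‖w‖_𝒜‖Tw‖_𝒜`,
using `‖𝒜^{-1/2}ψ_w‖_{L²} ≲ ‖w‖_𝒜` for zero-mass `w`.) Compare CoreLinearInvertibility at `lam = 0`:
same operator, weight `G⁻¹ = 4π e^{|x|²/4}` replaced by `𝒜 ≍ e^{|x|²/4}/|x|²`. -/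
def SteadyArnoldCoercivityGauss : Prop :=
  ∃ c : ℝ, 0 < c ∧ ∀ (R : ℝ) (w : ℝ² → ℝ), ContDiff ℝ ∞ w → HasCompactSupport w →
    ∫ x, w x = 0 → ∫ x, x 0 * w x = 0 → ∫ x, x 1 * w x = 0 →
    c ^ 2 * ∫ x, arnoldWeight x * w x ^ 2 ≤
      ∫ x, arnoldWeight x * (linCoreOp 0 (fun y => R * gaussVortexProfile y) w x) ^ 2

/-- **First lemma of the line (λ > 0, NEW): the Arnold identity at a TRUE strained vortex with an
explicit defect.** Let `ω̄` be a classical asymmetric Burgers vortex (`L_λ ω̄ = (K∗ω̄)·∇ω̄`, tree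
`IsClassicalAsymBurgersVortex lam R ω̄`), let `U = u_λ + K∗ω̄` be the TOTAL planar velocity (strain +
self-induction; `U = ∇^⊥Ψ̄`, so `∇Ψ̄ = −U^⊥`), and let `A` be ANY smooth positive weight. Then for every
smooth compactly supported `w`, with `T_{ω̄} w = L_λ w − (K∗ω̄)·∇w − (K∗w)·∇ω̄ = L w − {Ψ̄, w} − {ψ_w, ω̄}`:
`∫ (A w + ψ_w)·(T_{ω̄} w) = −Q_A(w) + ½ ∫ (U·∇A) w² − ∫ w ⟪K∗w, A∇ω̄ + ∇Ψ̄⟫`.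
(Integration by parts only: the three Gallay–Šverák cancellations redone for a general pair `(ω̄, A)`;
`∫ψ_w{ψ_w, ω̄} = 0` always.) WHY IT MATTERS: if `ω̄` were an exact Euler steady state and `A` its
Arnold weight (`∇Ψ̄ = −A∇ω̄`, hence `U·∇A = {Ψ̄, A}·(−1) = 0`) both defect terms vanish identically —
`R` never appears. For the viscous vortex at circulation `R → ∞` with `A = A_R := −∇Ψ̄·∇ω̄/|∇ω̄|²`
the defects are `o_R(1)` as forms on the inner region (the `O(λ)` part cancels by the
Moffatt–Kida–Ohkitani cell equation — Dolce–Gallay 2026, §3.5, "`F₂ ≡ 0`"), leaving Gallay–Šverák's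
λ-INDEPENDENT form `Q_𝒜` as the `R → ∞` limit. -/
def ArnoldSteadyIdentityStrained : Prop :=
  ∀ (lam R : ℝ) (ωbar : ℝ² → ℝ), IsClassicalAsymBurgersVortex lam R ωbar →
  ∀ (A : ℝ² → ℝ), ContDiff ℝ ∞ A → (∀ x, 0 < A x) →
  ∀ (w : ℝ² → ℝ), ContDiff ℝ ∞ w → HasCompactSupport w →
    ∫ x, (A x * w x + streamFn w x) * linCoreOp lam ωbar w x
      = - diffusiveForm A w
        + (1 / 2 : ℝ) * ∫ x, ⟪strainVel lam x + biotSavart2D ωbar x, gradient A x⟫_ℝ * w x ^ 2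
        - ∫ x, w x * ⟪biotSavart2D w x,
            A x • gradient ωbar x - perp (strainVel lam x + biotSavart2D ωbar x)⟫_ℝ

/-- **The line's sectional target at the true vortex (NEW; what the gluing consumes):** for every
asymmetry in a compact range `[0, λ₁]`, `λ₁ < 1`, there are `R₀, c > 0` and, for each classical
asymmetric Burgers vortex `ω̄` of circulation `R ≥ R₀`, a weight `A` with `𝒜/2 ≤ A ≤ 2𝒜` on the
inner region, such that `c²∫A w² ≤ ∫A (T_{ω̄}w)²` on `C_c^∞ ∩ {mass = first moments = 0}` — ALL
angular parities, linearised at the TRUE vortex, uniform in `R`. (Three-region weight à la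
Dolce–Gallay 2026 (def:Weps): Arnold weight inside the cat's eye, constant in an annulus, mild growth
outside.) Stated here in the simplest one-weight form. -/
def SteadyArnoldCoercivityStrained : Prop :=
  ∀ lam1 : ℝ, 0 ≤ lam1 → lam1 < 1 → ∃ R₀ c : ℝ, 0 < c ∧
    ∀ lam ∈ Set.Icc (0 : ℝ) lam1, ∀ (R : ℝ), R₀ ≤ R → ∀ (ωbar : ℝ² → ℝ),
      IsClassicalAsymBurgersVortex lam R ωbar →
      ∃ A : ℝ² → ℝ, ContDiff ℝ ∞ A ∧ (∀ x, 0 < A x) ∧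
        ∀ (w : ℝ² → ℝ), ContDiff ℝ ∞ w → HasCompactSupport w →
          ∫ x, w x = 0 → ∫ x, x 0 * w x = 0 → ∫ x, x 1 * w x = 0 →
          c ^ 2 * ∫ x, A x * w x ^ 2 ≤ ∫ x, A x * (linCoreOp lam ωbar w x) ^ 2

end Planar

/-! ## Card `core-choking` — the `m = 0` far tube as a Γ-free choked nozzle

Quasi-one-dimensional (hydraulic) model of one filament end in the similarity frame: ambient
tangential speed `w(τ)` (skeleton + drift; `w(τ_*) = 0`, `w ≈ τ/2` far out), core area `A(τ)`, frozen
circulation `κ`, swirl-pressure constant `C` (`= ln 2/(4π²)` for a Gaussian core: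
`stiff-core-axial-jet`'s `BurgersAxisPressureDeficit`), Bernoulli constant `E`. Axis Bernoulli gives
the TOTAL core speed `w_tot = √(w² + 2E + 2Cκ²/A)` and the similarity core-area law reads
`w_tot A' = (3/2 − w_tot') A + 4` (route support `CoreAreaNecessity` with `w ↦ w_tot`). Substituting,
the law is a first-order QUASI-LINEAR ODE for `A` whose leading coefficient
`w_tot + A ∂_A w_tot = (w_tot² − Cκ²/A)/w_tot` vanishes on the SONIC LINE `w_tot² = Cκ²/A`
(axial speed = long area-wave speed: Benjamin criticality). -/

section Choking

/-- Total core speed from axis Bernoulli: `w_tot² = w² + 2E + 2Cκ²/A`. -/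
def coreSpeed (C κ E w A : ℝ) : ℝ :=
  Real.sqrt (w ^ 2 + 2 * E + 2 * C * κ ^ 2 / A)

/-- **Sonic coefficient identity (PROVED).** Differentiating `w_tot` in `A` at fixed `(w, E)`:
`w_tot + A·∂_A w_tot = (w_tot² − Cκ²/A)/w_tot` whenever `w_tot > 0`, `A > 0` — so the area law,
written as an ODE for `A`, degenerates exactly where `w_tot² = Cκ²/A`. -/
theorem sonic_coefficient {C κ E w A : ℝ} (hA : 0 < A) (hpos : 0 < w ^ 2 + 2 * E + 2 * C * κ ^ 2 / A) :
    coreSpeed C κ E w A + A * deriv (fun a => coreSpeed C κ E w a) A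
      = ((coreSpeed C κ E w A) ^ 2 - C * κ ^ 2 / A) / coreSpeed C κ E w A := by
  unfold coreSpeed
  have hs : 0 < Real.sqrt (w ^ 2 + 2 * E + 2 * C * κ ^ 2 / A) := Real.sqrt_pos.2 hpos
  have hsq : (Real.sqrt (w ^ 2 + 2 * E + 2 * C * κ ^ 2 / A)) ^ 2 = w ^ 2 + 2 * E + 2 * C * κ ^ 2 / A :=
    Real.sq_sqrt hpos.le
  -- derivative of the radicand in `a`
  have hfun : (fun a : ℝ => w ^ 2 + 2 * E + 2 * C * κ ^ 2 / a)
      = fun a => w ^ 2 + 2 * E + 2 * C * κ ^ 2 * a⁻¹ := by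
    funext a; ring
  have hrad : HasDerivAt (fun a : ℝ => w ^ 2 + 2 * E + 2 * C * κ ^ 2 / a)
      (2 * C * κ ^ 2 * (-(A ^ 2)⁻¹)) A := by
    rw [hfun]
    exact ((hasDerivAt_inv hA.ne').const_mul (2 * C * κ ^ 2)).const_add (w ^ 2 + 2 * E)
  have hderiv := hrad.sqrt hpos.ne'
  rw [hderiv.deriv]
  set s := Real.sqrt (w ^ 2 + 2 * E + 2 * C * κ ^ 2 / A) with hs_def
  have hs0 : s ≠ 0 := hs.ne'
  have hA0 : A ≠ 0 := hA.ne'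
  field_simp
  ring

/-- **Regular branch at the core's stagnation section (PROVED; the tree's `CoreAreaNecessity` with the
jet included).** If the total core speed vanishes at `τs` and the similarity area law holds there
with `A(τs) > 0`, the jet's strain is `w_tot'(τs) = 3/2 + 4/A(τs)` — in particular supercritical for
EVERY core area: with an axial jet the stagnation stretching is supplied by the core itself, and the
area `A(τs)` is a FREE parameter of the regular branch (to be fixed by choking downstream), not the
passive value `4/(w'(τ_*) − 3/2)`. -/
theorem stagnation_jet_rate (wt A : ℝ → ℝ) (τs : ℝ) (h0 : wt τs = 0)
    (hlaw : wt τs * deriv A τs = (3 / 2 - deriv wt τs) * A τs + 4) (hA : 0 < A τs) :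
    deriv wt τs = 3 / 2 + 4 / A τs := by
  rw [h0, zero_mul] at hlaw
  have hA0 : A τs ≠ 0 := hA.ne'
  field_simp
  linarith [hlaw]

/-- **The fold mechanism of the drag-free closure (PROVED).** In the `Γ → ∞` limit on the scale
`s = τ/Γ` (ambient speed `s/2`, reservoir `2C(1/A − 1/A_s)`), the area ODE is `A' = N/D` with
`N = ((3/2)A + 4)·W − A s/4`, `D = W² − C/A`. Whenever the core is at least as fast as the ambient
(`W ≥ s/2`, forced on the contracting regular branch by Bernoulli) the numerator is bounded below by
`s(A/2 + 2) > 0`; since `D < 0` at the stagnation section and `D → +∞` along `s`, every such branch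
meets the sonic line `D = 0` with `N > 0`: a FOLD (`A' → −∞`), never a regular transonic passage.
Numerics (kit/choke_limit.py, local, < 1 s): fold at `s_c ≈ 0.014–0.040·γ` with `A_c ≈ A_s/2` for
`A_s ∈ [0.5, 20]`, `γ ∈ {½, 1, 2}` — universal, `C`-independent. -/
theorem dragFree_numerator_pos {A W s : ℝ} (hA : 0 < A) (hs : 0 < s) (hW : s / 2 ≤ W) :
    s * (A / 2 + 2) ≤ (3 / 2 * A + 4) * W - A * s / 4 ∧ 0 < (3 / 2 * A + 4) * W - A * s / 4 := by
  have h1 : (3 / 2 * A + 4) * (s / 2) ≤ (3 / 2 * A + 4) * W :=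
    mul_le_mul_of_nonneg_left hW (by positivity)
  constructor
  · nlinarith
  · nlinarith [mul_pos hs hA]

/-- **Drag-free fold (statement of the model theorem; the limit-ODE version of the numerics).** For
`C, A_s > 0`, any `C¹` solution `A > 0` on `[0, S)` of the limit law
`W A' = (3/2 − W')A + 4`, `W = √(s²/4 + 2C/A − 2C/A_s)`, `A(0) = A_s`, stays in the subcritical
region `W² < C/A` only on a bounded interval and cannot be continued as a `C¹` function across the
first point where `W² = C/A` (the one-sided derivative of `A` is unbounded there). A crux-plan seat
types it over Mathlib ODE vocabulary; recorded here as the NEGATIVE half of the dichotomy. -/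
def DragFreeFold : Prop :=
  ∀ (C As S : ℝ), 0 < C → 0 < As → 0 < S →
  ∀ (A : ℝ → ℝ), ContDiffOn ℝ 1 A (Set.Ico 0 S) → A 0 = As → (∀ s ∈ Set.Ico 0 S, 0 < A s) →
    (∀ s ∈ Set.Ioo 0 S, 0 < s ^ 2 / 4 + 2 * C / A s - 2 * C / As) →
    (∀ s ∈ Set.Ioo 0 S,
      coreSpeed C 1 (-(C / As)) (s / 2) (A s) * deriv A s
        = (3 / 2 - deriv (fun σ => coreSpeed C 1 (-(C / As)) (σ / 2) (A σ)) s) * A s + 4) →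
    (∀ s ∈ Set.Ioo 0 S, (coreSpeed C 1 (-(C / As)) (s / 2) (A s)) ^ 2 < C / A s) →
    S ^ 2 / 4 ≤ 2 * C / As

/-- **First OPEN statement of the line (the constructive half): a choked branch WITH the O(1)
axial-momentum exchange.** The honest slender closure on the `s`-scale carries a drag/entrainment
term of relative size `O(1)` (core radius `≍ 1`, `ν = 1`, transit similarity-time `O(1)`): axis
momentum `W W' = s/4 − C A'/A² − k·(W − s/2)/A` for some drag law (here the simplest linear one,
coefficient `k > 0` from the quasi-cylindrical momentum integral). CLAIM TO DECIDE: for the drag law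
derived from the steady similarity Navier–Stokes system there is a reservoir area `A_s` whose branch
crosses the sonic line regularly (numerator and denominator vanish together) and continues as a `C¹`
supercritical far cone. Stated with `k` as a parameter; the line's second stub derives `k` (and the
correct form of the exchange term). -/
def ChokedBranchWithDrag : Prop :=
  ∀ (C k : ℝ), 0 < C → 0 < k → ∃ (As : ℝ) (A W : ℝ → ℝ), 0 < As ∧
    ContDiffOn ℝ 1 A (Set.Ici 0) ∧ ContDiffOn ℝ 1 W (Set.Ici 0) ∧ A 0 = As ∧ W 0 = 0 ∧
    (∀ s, 0 ≤ s → 0 < A s) ∧ (∀ s, 0 < s → 0 < W s) ∧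
    (∀ s, 0 < s → W s * deriv A s = (3 / 2 - deriv W s) * A s + 4) ∧
    (∀ s, 0 < s → W s * deriv W s = s / 4 - C * deriv A s / (A s) ^ 2 - k * (W s - s / 2) / A s) ∧
    (∃ sc, 0 < sc ∧ (W sc) ^ 2 = C / A sc) ∧
    Filter.Tendsto (fun s => (W s) ^ 2 - C / A s) Filter.atTop Filter.atTop

end Choking

end Summit.NavierStokesRegularity.NavierStokesRegularity.Cruxes.CoreGluingGivenInvertibility.Sketch
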